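import Mathlib
import HarnessLib

/-!
# Apéry's double table (Apéry 1981; Rajkumar 2012)

The algebraic core of Apéry's *second* proof of the irrationality of `ζ(3)` (R. Apéry,
*Interpolation de fractions continues et irrationalité de certaines constantes*, 1981), in the
form given by K. Rajkumar, *A simplification of Apéry's proof of the irrationality of `ζ(3)`*,
arXiv:1212.5881 (2012), §2. With the cubic forms
`f(i,j) = i³ + 2i²j + 2ij² + j³`, `g(i,j) = i³ - 2i²j + 2ij² - j³` one considers tables
`u : ℕ × ℕ → ℚ` solving the two-dimensional recurrence [Rajkumar2012, (rec1)]

  `i³ u(i,j)   = f(i,j) u(i-1,j) - j³ u(i-1,j-1)`,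
  `i³ u(i,j-1) = j³ u(i-1,j)     + g(i,j) u(i-1,j-1)`      (`i, j ≥ 1`).

We *define* `table r` from a boundary sequence `r` (`u(0,j) = r j`, `u(i,0) = r i`) by the first
line, and prove (Rajkumar's Proposition 1) that when `r` satisfies the three-term relation
`(j+2)³ r(j+2) = ((j+1)³ + (j+2)³) r(j+1) - (j+1)³ r(j)` (`Boundary r`; both `r ≡ 1` and
`r = H₃`, `H₃(n) = ∑_{m ≤ n} m⁻³`, do) the second line, the inverted system
[Rajkumar2012, (rec3)] and the row relation [Rajkumar2012, (rec2)] all hold. The key inputs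
are the identities `f g = i⁶ - j⁶` and `f(i+1,j) - f(i,j+1) = g(i+1,j+1) - g(i,j)`
[Rajkumar2012, (cond1), (cond2)]. Finally `exists_int_combination` is the heart of Rajkumar's
Proposition 2: `u(i,j)` is a `ℤ`-combination of `u(i,j-1)`, `u(i-1,j)`, `u(i-1,j-1)` (Bezout on
`i'³, j'³` after dividing by `gcd(i,j)³`).

The two tables `qT = table 1` (Apéry's denominators, `qT n n` = the Apéry numbers
`1, 5, 73, 1445, …`) and `pT = table H₃` are introduced at the end; their positivity,
Casoratians, growth and integrality are in `AperyTableBounds.lean`, and the irrationality of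
`ζ(3)` in `AperyIrrationality.lean`.

Design: everything is over `ℚ` with indices shifted so that no natural subtraction occurs
(`i+1`, `j+1` in place of `i, j ≥ 1`). Not here: the diagonal (Apéry) recurrence
`(n+1)³uₙ₊₁ = (34n³+51n²+27n+5)uₙ - n³uₙ₋₁` and Poincaré–Perron asymptotics (Rajkumar §3), which
we replace by an elementary growth bootstrap in `AperyTableBounds.lean`.

## References
* [Apery1981] R. Apéry, Interpolation de fractions continues…, Bull. Sect. Sci. C.T.H.S. III (1981) 37–53.
* [Rajkumar2012] K. Rajkumar, arXiv:1212.5881, §2 (Propositions 1, 2).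
* [VanDerPoorten1979] A. van der Poorten, A proof that Euler missed…, Math. Intelligencer 1 (1979).
-/

open Finset

namespace Literature.NumberTheory.Transcendental

namespace Apery

/-- Apéry's cubic form `f(i,j) = i³ + 2i²j + 2ij² + j³` (as a polynomial function on `ℚ`).
[cite: Rajkumar2012, §2 (f-g-def)] -/
def f (i j : ℚ) : ℚ := i ^ 3 + 2 * i ^ 2 * j + 2 * i * j ^ 2 + j ^ 3

/-- Apéry's cubic form `g(i,j) = i³ - 2i²j + 2ij² - j³` (as a polynomial function on `ℚ`).
[cite: Rajkumar2012, §2 (f-g-def)] -/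
def g (i j : ℚ) : ℚ := i ^ 3 - 2 * i ^ 2 * j + 2 * i * j ^ 2 - j ^ 3

/-- (cond1): `f(i,j) g(i,j) = f(i,0)g(i,0) + f(0,j)g(0,j) = i⁶ - j⁶`. [cite: Rajkumar2012, §2 (cond1)] -/
theorem f_mul_g (i j : ℚ) : f i j * g i j = i ^ 6 - j ^ 6 := by
  unfold f g; ring

/-- (cond2): `f(i+1,j) - f(i,j+1) = g(i+1,j+1) - g(i,j)`. [cite: Rajkumar2012, §2 (cond2)] -/
theorem f_sub_f (i j : ℚ) : f (i + 1) j - f i (j + 1) = g (i + 1) (j + 1) - g i j := by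
  unfold f g; ring

/-- The table generated from a boundary sequence `r` by the first line of Apéry's recurrence
(rec1): `u(0,j) = r j`, `u(i,0) = r i`, and for `i, j ≥ 1`
`u(i,j) = (f(i,j) u(i-1,j) - j³ u(i-1,j-1)) / i³`. [cite: Rajkumar2012, §2 Prop. 1 (rec1)] -/
def table (r : ℕ → ℚ) : ℕ → ℕ → ℚ
  | 0, j => r j
  | i + 1, 0 => r (i + 1)
  | i + 1, j + 1 =>
      (f ((i : ℚ) + 1) ((j : ℚ) + 1) * table r i (j + 1) - ((j : ℚ) + 1) ^ 3 * table r i j) /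
        ((i : ℚ) + 1) ^ 3

variable (r : ℕ → ℚ)

/-- Row `0` of the table is the boundary sequence. [cite: Rajkumar2012, §2 Prop. 1] -/
@[simp] theorem table_zero_left (j : ℕ) : table r 0 j = r j := by
  simp [table]

/-- Column `0` of the table is the boundary sequence. [cite: Rajkumar2012, §2 Prop. 1] -/
@[simp] theorem table_zero_right (i : ℕ) : table r i 0 = r i := by
  cases i <;> simp [table]

/-- The defining equation of the interior entries. [cite: Rajkumar2012, §2 Prop. 1 (rec1)] -/
theorem table_succ_succ (i j : ℕ) :
    table r (i + 1) (j + 1) =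
      (f ((i : ℚ) + 1) ((j : ℚ) + 1) * table r i (j + 1) - ((j : ℚ) + 1) ^ 3 * table r i j) /
        ((i : ℚ) + 1) ^ 3 := by
  simp [table]

/-- First line of (rec1): `i³ u(i,j) = f(i,j) u(i-1,j) - j³ u(i-1,j-1)` (here with `i+1, j+1`).
[cite: Rajkumar2012, §2 Prop. 1 (rec1)] -/
theorem rec_fst (i j : ℕ) :
    ((i : ℚ) + 1) ^ 3 * table r (i + 1) (j + 1) =
      f ((i : ℚ) + 1) ((j : ℚ) + 1) * table r i (j + 1) - ((j : ℚ) + 1) ^ 3 * table r i j := by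
  rw [table_succ_succ, mul_div_cancel₀ _ (by positivity)]

/-- The three-term relation (rec2) along row `i` of a table `u`:
`(j+2)³ u(j+2) = (f(i+1,j+1) - g(i+1,j+2)) u(j+1) - (j+1)³ u(j)`.
[cite: Rajkumar2012, §2 Prop. 1 (rec2)] -/
def RowRel (u : ℕ → ℚ) (i : ℕ) : Prop :=
  ∀ j : ℕ, ((j : ℚ) + 2) ^ 3 * u (j + 2) =
    (f ((i : ℚ) + 1) ((j : ℚ) + 1) - g ((i : ℚ) + 1) ((j : ℚ) + 2)) * u (j + 1)
      - ((j : ℚ) + 1) ^ 3 * u j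

/-- The boundary hypothesis: `r` satisfies (rec2) for row `0`, i.e.
`(j+2)³ r(j+2) = ((j+1)³ + (j+2)³) r(j+1) - (j+1)³ r(j)` (note `f(1,j+1) - g(1,j+2) =
(j+1)³ + (j+2)³`). Both boundary conditions (a) `r ≡ 1` and (b) `r = H₃` of Rajkumar's
Proposition 1 satisfy it (`boundary_one`, `boundary_H3`). [cite: Rajkumar2012, §2 Prop. 1] -/
def Boundary (r : ℕ → ℚ) : Prop :=
  ∀ j : ℕ, ((j : ℚ) + 2) ^ 3 * r (j + 2) =
    (((j : ℚ) + 1) ^ 3 + ((j : ℚ) + 2) ^ 3) * r (j + 1) - ((j : ℚ) + 1) ^ 3 * r j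

variable {r}

/-- The entries `u(i+1,1)` from the defining equation. [cite: Rajkumar2012, §2 Prop. 1 (rec1)] -/
theorem table_succ_one (i : ℕ) :
    table r (i + 1) 1 = (f ((i : ℚ) + 1) 1 * table r i 1 - r i) / ((i : ℚ) + 1) ^ 3 := by
  change table r (i + 1) (0 + 1) = _
  rw [table_succ_succ]
  simp

/-- Column `1` in closed form: `u(i,1) = (i+1)³ r(i+1) - g(i+1,1) r(i)` (this is the column
boundary consistency "`qᵢ,₁ = P(0,i)`, `pᵢ,₁ = P(0,i) pᵢ,₀ + 1`" of Rajkumar, §4).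
[cite: Rajkumar2012, §2 Prop. 1 (proof, column j=0) and §4] -/
theorem col_one (hr : Boundary r) (i : ℕ) :
    table r i 1 = ((i : ℚ) + 1) ^ 3 * r (i + 1) - g ((i : ℚ) + 1) 1 * r i := by
  induction i with
  | zero => simp [g]
  | succ i ih =>
    rw [table_succ_one, ih, div_eq_iff (by positivity)]
    rw [show i + 1 + 1 = i + 2 from rfl]
    have h := hr i
    unfold f g at *
    push_cast
    linear_combination (-((i : ℚ) + 1) ^ 3) * h

/-- Row `0` satisfies (rec2) — the base case of Rajkumar's induction. [cite: Rajkumar2012, §2 Prop. 1] -/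
theorem rowRel_zero (hr : Boundary r) : RowRel (table r 0) 0 := by
  intro j
  simp only [table_zero_left]
  have h := hr j
  unfold f g
  push_cast
  linear_combination h

/-- Inductive step: if row `i` satisfies (rec2) then the second line of (rec1) holds between rows
`i` and `i+1`: `(i+1)³ u(i+1,j) = (j+1)³ u(i,j+1) + g(i+1,j+1) u(i,j)`.
[cite: Rajkumar2012, §2 Prop. 1 (proof)] -/
theorem rec_snd_of_rowRel (hr : Boundary r) {i : ℕ} (hi : RowRel (table r i) i) (j : ℕ) :
    ((i : ℚ) + 1) ^ 3 * table r (i + 1) j =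
      ((j : ℚ) + 1) ^ 3 * table r i (j + 1) + g ((i : ℚ) + 1) ((j : ℚ) + 1) * table r i j := by
  cases j with
  | zero =>
    simp only [Nat.cast_zero, zero_add, table_zero_right, col_one hr]
    unfold g
    ring
  | succ j =>
    rw [show j + 1 + 1 = j + 2 from rfl]
    have h1 := rec_fst r i j
    have h2 := hi j
    unfold f g at *
    push_cast at *
    linear_combination h1 - h2

/-- (rec3), top line, from both lines of (rec1) and (cond1):
`g(i+1,j+1) u(i+1,j+1) + (j+1)³ u(i+1,j) = (i+1)³ u(i,j+1)`. [cite: Rajkumar2012, §2 Prop. 1 (rec3)] -/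
theorem rec3_top_of_rec_snd {i : ℕ}
    (h : ∀ j : ℕ, ((i : ℚ) + 1) ^ 3 * table r (i + 1) j =
      ((j : ℚ) + 1) ^ 3 * table r i (j + 1) + g ((i : ℚ) + 1) ((j : ℚ) + 1) * table r i j)
    (j : ℕ) :
    g ((i : ℚ) + 1) ((j : ℚ) + 1) * table r (i + 1) (j + 1)
        + ((j : ℚ) + 1) ^ 3 * table r (i + 1) j =
      ((i : ℚ) + 1) ^ 3 * table r i (j + 1) := by
  have h1 := rec_fst r i j
  have h2 := h j
  have h3 := f_mul_g ((i : ℚ) + 1) ((j : ℚ) + 1)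
  have hi : ((i : ℚ) + 1) ^ 3 ≠ 0 := by positivity
  apply mul_left_cancel₀ hi
  linear_combination (g ((i : ℚ) + 1) ((j : ℚ) + 1)) * h1 + ((j : ℚ) + 1) ^ 3 * h2 +
    (table r i (j + 1)) * h3

/-- (rec3), bottom line: `f(i+1,j+1) u(i+1,j) - (j+1)³ u(i+1,j+1) = (i+1)³ u(i,j)`.
[cite: Rajkumar2012, §2 Prop. 1 (rec3)] -/
theorem rec3_bot_of_rec_snd {i : ℕ}
    (h : ∀ j : ℕ, ((i : ℚ) + 1) ^ 3 * table r (i + 1) j =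
      ((j : ℚ) + 1) ^ 3 * table r i (j + 1) + g ((i : ℚ) + 1) ((j : ℚ) + 1) * table r i j)
    (j : ℕ) :
    f ((i : ℚ) + 1) ((j : ℚ) + 1) * table r (i + 1) j
        - ((j : ℚ) + 1) ^ 3 * table r (i + 1) (j + 1) =
      ((i : ℚ) + 1) ^ 3 * table r i j := by
  have h1 := rec_fst r i j
  have h2 := h j
  have h3 := f_mul_g ((i : ℚ) + 1) ((j : ℚ) + 1)
  have hi : ((i : ℚ) + 1) ^ 3 ≠ 0 := by positivity
  apply mul_left_cancel₀ hi
  linear_combination (f ((i : ℚ) + 1) ((j : ℚ) + 1)) * h2 - ((j : ℚ) + 1) ^ 3 * h1 +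
    (table r i j) * h3

/-- **Rajkumar's Proposition 1**: every row of the table satisfies the row relation (rec2)
(induction on the rows via (rec3) and (cond2)). [cite: Rajkumar2012, §2 Prop. 1] -/
theorem rowRel (hr : Boundary r) : ∀ i : ℕ, RowRel (table r i) i := by
  intro i
  induction i with
  | zero => exact rowRel_zero hr
  | succ i ih =>
    intro j
    have h2 := rec_snd_of_rowRel hr ih
    have h3 := rec3_top_of_rec_snd h2 j
    have h4 := rec3_bot_of_rec_snd h2 (j + 1)
    have h5 := f_sub_f ((i : ℚ) + 1) ((j : ℚ) + 1)
    rw [show j + 1 + 1 = j + 2 from rfl] at h4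
    unfold f g at *
    push_cast at *
    linear_combination h3 - h4 - (table r (i + 1) (j + 1)) * h5

/-- Second line of (rec1): `(i+1)³ u(i+1,j) = (j+1)³ u(i,j+1) + g(i+1,j+1) u(i,j)`.
[cite: Rajkumar2012, §2 Prop. 1 (rec1)] -/
theorem rec_snd (hr : Boundary r) (i j : ℕ) :
    ((i : ℚ) + 1) ^ 3 * table r (i + 1) j =
      ((j : ℚ) + 1) ^ 3 * table r i (j + 1) + g ((i : ℚ) + 1) ((j : ℚ) + 1) * table r i j :=
  rec_snd_of_rowRel hr (rowRel hr i) j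

/-- (rec3), top line. [cite: Rajkumar2012, §2 Prop. 1 (rec3)] -/
theorem rec3_top (hr : Boundary r) (i j : ℕ) :
    g ((i : ℚ) + 1) ((j : ℚ) + 1) * table r (i + 1) (j + 1)
        + ((j : ℚ) + 1) ^ 3 * table r (i + 1) j =
      ((i : ℚ) + 1) ^ 3 * table r i (j + 1) :=
  rec3_top_of_rec_snd (rec_snd hr i) j

/-- (rec3), bottom line. [cite: Rajkumar2012, §2 Prop. 1 (rec3)] -/
theorem rec3_bot (hr : Boundary r) (i j : ℕ) :
    f ((i : ℚ) + 1) ((j : ℚ) + 1) * table r (i + 1) j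
        - ((j : ℚ) + 1) ^ 3 * table r (i + 1) (j + 1) =
      ((i : ℚ) + 1) ^ 3 * table r i j :=
  rec3_bot_of_rec_snd (rec_snd hr i) j

/-- Diagonal step `u(n+1,n+1) = 6 u(n,n+1) - u(n,n)` (first line of (rec1) at `i = j`, where
`f(n,n) = 6n³`; the matrix `(6, -1; 1, 0)` of Rajkumar §3). [cite: Rajkumar2012, §3 (A_n)] -/
theorem diag_succ (n : ℕ) :
    table r (n + 1) (n + 1) = 6 * table r n (n + 1) - table r n n := by
  have h := rec_fst r n n
  have hn : ((n : ℚ) + 1) ^ 3 ≠ 0 := by positivity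
  apply mul_left_cancel₀ hn
  unfold f at h
  linear_combination h

/-- `u(n+1,n) = u(n,n+1)` (second line of (rec1) at `i = j`, where `g(n,n) = 0`).
[cite: Rajkumar2012, §3 (A_n)] -/
theorem sub_diag (hr : Boundary r) (n : ℕ) : table r (n + 1) n = table r n (n + 1) := by
  have h := rec_snd hr n n
  have hn : ((n : ℚ) + 1) ^ 3 ≠ 0 := by positivity
  apply mul_left_cancel₀ hn
  unfold g at h
  linear_combination h

/-- The super-diagonal from the diagonal (row relation at `j = n`, using `sub_diag`):
`(n+2)³ u(n+1,n+2) = (6(n+1)³ + 9(n+1)² + 5(n+1) + 1) u(n+1,n+1) - (n+1)³ u(n,n+1)`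
(the first row of Rajkumar's matrix `A_n`). [cite: Rajkumar2012, §3 (A_n)] -/
theorem super_diag (hr : Boundary r) (n : ℕ) :
    ((n : ℚ) + 2) ^ 3 * table r (n + 1) (n + 2) =
      (6 * ((n : ℚ) + 1) ^ 3 + 9 * ((n : ℚ) + 1) ^ 2 + 5 * ((n : ℚ) + 1) + 1)
          * table r (n + 1) (n + 1)
        - ((n : ℚ) + 1) ^ 3 * table r n (n + 1) := by
  have h := rowRel hr (n + 1) n
  rw [sub_diag hr n] at h
  unfold f g at h
  push_cast at h ⊢
  linear_combination h

/-- **Integrality engine** (Rajkumar's Proposition 2, first statement): each interior entry is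
a `ℤ`-linear combination of its three lower neighbours. Proof: write `i = i'd`, `j = j'd` with
`d = gcd(i,j)`; divide (rec1) by `d³` (homogeneity of `f, g`); with `a i'³ + b j'³ = 1` one gets
`u(i,j) = b f' u(i,j-1) + a f' u(i-1,j) - (a j'³ + b i'³) u(i-1,j-1)`, `f' = f(i',j')`, using
(cond1) `f' g' = i'⁶ - j'⁶`. [cite: Rajkumar2012, §2 Prop. 2] -/
theorem exists_int_combination (hr : Boundary r) (i j : ℕ) :
    ∃ x y z : ℤ, table r (i + 1) (j + 1) =
      x * table r (i + 1) j + y * table r i (j + 1) + z * table r i j := by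
  obtain ⟨i', j', hco, hi, hj⟩ := Nat.exists_coprime (i + 1) (j + 1)
  set d := Nat.gcd (i + 1) (j + 1)
  have hcop : IsCoprime ((i' : ℤ) ^ 3) ((j' : ℤ) ^ 3) :=
    (Nat.isCoprime_iff_coprime.mpr hco).pow
  obtain ⟨a, b, hab⟩ := hcop
  have h1 := rec_fst r i j
  have h2 := rec_snd hr i j
  -- rational versions of the data
  have hiq : ((i : ℚ) + 1) = (i' : ℚ) * (d : ℚ) := by exact_mod_cast hi
  have hjq : ((j : ℚ) + 1) = (j' : ℚ) * (d : ℚ) := by exact_mod_cast hj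
  have habq : (a : ℚ) * (i' : ℚ) ^ 3 + (b : ℚ) * (j' : ℚ) ^ 3 = 1 := by exact_mod_cast hab
  have hF : f ((i : ℚ) + 1) ((j : ℚ) + 1) = (d : ℚ) ^ 3 * f i' j' := by
    rw [hiq, hjq]; unfold f; ring
  have hG : g ((i : ℚ) + 1) ((j : ℚ) + 1) = (d : ℚ) ^ 3 * g i' j' := by
    rw [hiq, hjq]; unfold g; ring
  have hfg : f i' j' * g i' j' = (i' : ℚ) ^ 6 - (j' : ℚ) ^ 6 := f_mul_g _ _
  -- `f i' j'` is an integer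
  obtain ⟨F, hFint⟩ : ∃ F : ℤ, (F : ℚ) = f i' j' :=
    ⟨(i' : ℤ) ^ 3 + 2 * (i' : ℤ) ^ 2 * j' + 2 * i' * (j' : ℤ) ^ 2 + (j' : ℤ) ^ 3, by
      unfold f; push_cast; ring⟩
  refine ⟨b * F, a * F, -(a * (j' : ℤ) ^ 3 + b * (i' : ℤ) ^ 3), ?_⟩
  push_cast
  rw [hFint]
  have hne : ((i : ℚ) + 1) ^ 3 ≠ 0 := by positivity
  apply mul_left_cancel₀ hne
  rw [hF] at h1
  rw [hG] at h2
  rw [hiq, hjq] at h1 h2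
  rw [hiq]
  linear_combination h1 - ((b : ℚ) * f i' j') * h2
    + ((d : ℚ) ^ 3 * ((j' : ℚ) ^ 3 * table r i j - f i' j' * table r i (j + 1))) * habq
    - ((d : ℚ) ^ 3 * (b : ℚ) * table r i j) * hfg

/-! ### The boundary sequences and the two tables -/

/-- `H₃(n) = ∑_{m=1}^{n} 1/m³ = ∑_{m<n} 1/(m+1)³` as a rational number (no junk terms).
[folklore] -/
def H3 (n : ℕ) : ℚ := ∑ m ∈ range n, 1 / ((m : ℚ) + 1) ^ 3

/-- `H₃(0) = 0`. [folklore] -/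
theorem H3_zero : H3 0 = 0 := by simp [H3]

/-- `H₃(n+1) = H₃(n) + 1/(n+1)³`. [folklore] -/
theorem H3_succ (n : ℕ) : H3 (n + 1) = H3 n + 1 / ((n : ℚ) + 1) ^ 3 := by
  rw [H3, sum_range_succ, H3]

/-- Boundary condition (a) of Rajkumar's Proposition 1: the constant sequence `1` satisfies the
row relation. [cite: Rajkumar2012, §2 Prop. 1 (a)] -/
theorem boundary_one : Boundary (fun _ => 1) := by
  intro j; ring

/-- Boundary condition (b) of Rajkumar's Proposition 1: `H₃` satisfies the row relation
`(j+2)³ H₃(j+2) = ((j+1)³ + (j+2)³) H₃(j+1) - (j+1)³ H₃(j)`. [cite: Rajkumar2012, §2 Prop. 1 (b)] -/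
theorem boundary_H3 : Boundary H3 := by
  intro j
  rw [show j + 2 = j + 1 + 1 from rfl, H3_succ, H3_succ]
  push_cast
  field_simp
  ring

/-- Apéry's table of denominators `q_{i,j}` (boundary `1`); its diagonal `qT n n` is the sequence
of Apéry numbers `1, 5, 73, 1445, …`. [cite: Rajkumar2012, §2 (after Prop. 1)] -/
def qT : ℕ → ℕ → ℚ := table fun _ => 1

/-- Apéry's table of numerators `p_{i,j}` (boundary `H₃`). [cite: Rajkumar2012, §2 (after Prop. 1)] -/
def pT : ℕ → ℕ → ℚ := table H3

/-- `q_{0,j} = 1`. [cite: Rajkumar2012, §2 Prop. 1 (a)] -/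
@[simp] theorem qT_zero_left (j : ℕ) : qT 0 j = 1 := table_zero_left _ j

/-- `q_{i,0} = 1`. [cite: Rajkumar2012, §2 Prop. 1 (a)] -/
@[simp] theorem qT_zero_right (i : ℕ) : qT i 0 = 1 := table_zero_right _ i

/-- `p_{0,j} = H₃(j)`. [cite: Rajkumar2012, §2 Prop. 1 (b)] -/
@[simp] theorem pT_zero_left (j : ℕ) : pT 0 j = H3 j := table_zero_left _ j

/-- `p_{i,0} = H₃(i)`. [cite: Rajkumar2012, §2 Prop. 1 (b)] -/
@[simp] theorem pT_zero_right (i : ℕ) : pT i 0 = H3 i := table_zero_right _ i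

end Apery

end Literature.NumberTheory.Transcendental
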